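import Summits.CriticalPhenomena.PercolationContinuityZ3.Theses.PercNearOneGluing
import Literature.Probability.Percolation.PercolationProofs
import Literature.Probability.Percolation.ConditionalPositiveAssociationProofs
import Literature.Probability.Percolation.TwoClusterConditionalAssociationProofs

/-! TTRL-lite variant V1421 of stmt-CriticalPhenomena-4576 -/

namespace Summit.CriticalPhenomena.PercolationContinuityZ3.Theorems

open MeasureTheory Literature.Probability.LatticeModels Literature.Probability.Percolation
open scoped Classical BigOperators

/-- TTRL-lite variant V1421 (gluing ONE pair, combinatorial core) of stmt-CriticalPhenomena-4576:
after inserting the bond `s(o, x)` into `ω`, `a ↔ b` iff already `a ↔ b`, or `a ↔ o` and `x ↔ b`,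
or `a ↔ x` and `o ↔ b` in `ω` (a walk either avoids the new edge or crosses it; the loop case
`o = x` adds no adjacency). [folklore] -/
theorem stub_goodStep_var1421 :
    ∀ (n : ℕ) (o x a b : Fin n), {ω : BondConfig (Fin n) | insert s(o, x) ω ∈ openConn a b} =
      openConn a b ∪ (openConn a o ∩ openConn x b) ∪ (openConn a x ∩ openConn o b) := by
  intro n o x a b
  ext ω
  simp only [Set.mem_setOf_eq, openConn, Set.mem_union, Set.mem_inter_iff]
  -- monotonicity of the open graph under insertion of a bond
  have hle : openGraph ω ≤ openGraph (insert s(o, x) ω) := by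
    intro u v huv
    rw [openGraph_adj] at huv ⊢
    exact ⟨Set.mem_insert_of_mem _ huv.1, huv.2⟩
  constructor
  · rintro ⟨p⟩
    -- induction over a walk in the enlarged open graph
    induction p with
    | nil => exact Or.inl (Or.inl (SimpleGraph.Reachable.refl _))
    | @cons u v c huv _ ih =>
      rw [openGraph_adj, Set.mem_insert_iff] at huv
      obtain ⟨huv | huv, hne⟩ := huv
      · -- the step is the new bond, `s(u, v) = s(o, x)`
        rcases Sym2.eq_iff.1 huv with ⟨rfl, rfl⟩ | ⟨rfl, rfl⟩
        · -- `u = o`, `v = x`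
          rcases ih with (h | ⟨-, h2⟩) | ⟨-, h2⟩
          · exact Or.inl (Or.inr ⟨SimpleGraph.Reachable.refl _, h⟩)
          · exact Or.inl (Or.inr ⟨SimpleGraph.Reachable.refl _, h2⟩)
          · exact Or.inl (Or.inl h2)
        · -- `u = x`, `v = o`
          rcases ih with (h | ⟨-, h2⟩) | ⟨-, h2⟩
          · exact Or.inr ⟨SimpleGraph.Reachable.refl _, h⟩
          · exact Or.inl (Or.inl h2)
          · exact Or.inr ⟨SimpleGraph.Reachable.refl _, h2⟩
      · -- the step is an old bond
        have hadj : (openGraph ω).Adj u v := (openGraph_adj ω u v).2 ⟨huv, hne⟩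
        rcases ih with (h | ⟨h1, h2⟩) | ⟨h1, h2⟩
        · exact Or.inl (Or.inl (hadj.reachable.trans h))
        · exact Or.inl (Or.inr ⟨hadj.reachable.trans h1, h2⟩)
        · exact Or.inr ⟨hadj.reachable.trans h1, h2⟩
  · have hox : (openGraph (insert s(o, x) ω)).Reachable o x := by
      by_cases e : o = x
      · subst e
        exact SimpleGraph.Reachable.refl _
      · exact ((openGraph_adj _ o x).2 ⟨Set.mem_insert _ _, e⟩).reachable
    rintro ((h | ⟨h1, h2⟩) | ⟨h1, h2⟩)
    · exact h.mono hle
    · exact ((h1.mono hle).trans hox).trans (h2.mono hle)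
    · exact ((h1.mono hle).trans hox.symm).trans (h2.mono hle)

end Summit.CriticalPhenomena.PercolationContinuityZ3.Theorems
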